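import Mathlib
import Summits.NavierStokesRegularity.NavierStokesRegularity.Theses.TypeIQuarterGate
import HarnessLib

/-!
# `TypeIQuarterGate.Assembly` — the route's assembly (item stmt-NavierStokesRegularity-23728; pure logic)

**Statement.** `QuarterLawTypeI → QuarterZoom → ParabolicGaldiLiouville → NoTypeII →
NavierStokesRegularity`.

PROOF. The route file carries the planner-authored, kernel-checked deciding theorem
`Theses.TypeIQuarterGate.closes` with exactly these hypotheses; the assembly is its curried form.
An IMPLICATION only: the hypotheses (three of them open cruxes) remain hypotheses.

HONEST FRAMING: pure logic between the route's own statements; the file does NOT prove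
`NavierStokesRegularity`.
-/

noncomputable section

set_option linter.dupNamespace false

namespace Summit.NavierStokesRegularity.NavierStokesRegularity.Theorems

open Summit.NavierStokesRegularity.NavierStokesRegularity.Theses.TypeIQuarterGate in
/-- **Item stmt-NavierStokesRegularity-23728** (`TypeIQuarterGate.Assembly`): the route's items imply the
sub-problem Statement, by the route file's deciding theorem `closes` (an implication; its hypotheses
stay hypotheses). [this file] -/
theorem typeIQuarterGate_assembly_proof :
    Summit.NavierStokesRegularity.NavierStokesRegularity.Theses.TypeIQuarterGate.Assembly := by
  unfold Summit.NavierStokesRegularity.NavierStokesRegularity.Theses.TypeIQuarterGate.Assembly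
  intro h₁ h₂ h₃ h₄
  exact closes h₁ h₂ h₃ h₄

end Summit.NavierStokesRegularity.NavierStokesRegularity.Theorems

end
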